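import Literature.Geometry.Symplectic.AlmostComplexTopChernNumberFourSign
import Literature.Geometry.Symplectic.HirzebruchSignatureAlmostComplexFourReduction
import Literature.Geometry.Symplectic.CanonicalClass
import Literature.Geometry.Kaehler.ProjectiveSpaceEulerSequence
import Literature.Geometry.Symplectic.PlusOneSpherePairModel
import Literature.Topology.FourManifolds.ConnectedSumEulerCharacteristic
import Literature.AlgebraicTopology.SingularHomology.IntersectionFormPositiveRealClass
import HarnessLib

/-!
# The top Chern number theorem in dimension four: `⟨c₂(TN, J), [N]_μ⟩ = χ(N)`

D. McDuff, D. Salamon, *Introduction to Symplectic Topology*, 3rd ed. (2017), Ex. 4.4.3 (v),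
Example 4.3.3 (`(ℂℙⁿ, ω_FS)`), Rem. 4.1.10; F. Hirzebruch, *Topological Methods in Algebraic
Geometry* (1966), Thm. 4.10.1, Thm. 4.5.1; J. Milnor, J. Stasheff, *Characteristic Classes* (1974),
Cor. 11.12, Thm. 14.10, Example 15.6.

The tree proves `⟨c₂(TN, J), [N]_μ⟩ = ε u · χ(N)` for every closed connected almost complex
`4`-manifold and every orientation `μ` induced by `J`, with ONE universal bit `ε u = chernSignBit`
(`kroneckerPairing_chernClass_two_of_isComplexOrientationOf`), pinned by one example
(`chernSignBit_eq_one_of_example`).  This file computes the example **`(ℂℙ², ω_FS)`** WITHOUT any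
orientation convention, from results already in the tree:

* `p₁(Tℂℙ²) = 3x²` (`tangentPontryaginClass_one_complexProjectiveSpace_two`, Milnor–Stasheff
  Example 15.6 through the real Euler sequence) and `⟨c₁² - 2c₂, [N]⟩ = ⟨p₁, [N]⟩`
  (`firstChernClass_sq_sub_two_mul_chernNumber_eq_pontryaginNumber`, Hirzebruch Thm. 4.5.1);
* `χ(ℂℙ²) = 3` (`relEuler_complexProjectivePlane`), `H²(ℂℙ²; ℤ)/T ≅ ℤ`
  (`freeCohomologyTwoLinearEquivInt`) with unimodular cup form (Poincaré duality,
  `isPerfPair_cupPairingModTorsion_holds`): `Q(g, g) = ±1` for the generator `g`;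
* the Fubini–Study form `ω` is symplectic (`CPn.fsForm`, at the literal model `𝓡 4`:
  `PlusOneSpherePair.model_isSmoothForm` …), a compatible `J` exists
  (`compatibleAlmostComplexStructureOf`) and induces the symplectic orientation `μ`
  (`isSymplecticOrientationOf_iff_isComplexOrientationOf`): `0 < ⟨[ω] ⌣ [ω], [ℂℙ²]_μ⟩`; since
  `[ω] = t (g ⊗ 1)` in `H²(ℂℙ²; ℝ) = ℝ (g ⊗ 1)` (`span_ringChange_eq_top`), `0 < t² Q(g, g)`, so
  **`Q(g, g) = +1`** on the complex orientation;
* hence, writing `c₁ ≡ a g`, `x ≡ m g` modulo torsion: `a² - 2 · (3 ε u) = 3 m²`, and `ε u = -1`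
  would give `a² + 6 = 3m²`, impossible modulo `3`.

Results:

* `chernSignBit_eq_one` — **`ε u = 1`**;
* **`kroneckerPairing_chernClass_two_eq_relEuler`** — **`⟨c₂(TN, J), [N]_μ⟩ = χ(N)` for every
  closed connected almost complex `4`-manifold and every homological orientation induced by `J`**
  (McDuff–Salamon Ex. 4.4.3 (v); Hirzebruch Thm. 4.10.1; Milnor–Stasheff Cor. 11.12);
* `hirzebruch_firstChernClass_sq_eq_almostComplex_four_of_signatureTheorem` — the named fact
  `c₁² = 2χ + 3σ` follows from the signature theorem `⟨p₁, [N]⟩ = 3σ` ALONE;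
* `even_one_add_bOne_add_bPlus_of_symplectic_four_of_signatureTheorem_of_wuClass` — the named fact
  `even_one_add_bOne_add_bPlus_of_symplectic_four` follows from the signature theorem and (V)
  `c₁ ≡ v₂ (mod 2)`.

Everything is proved; no named facts.

## References

* [McDuffSalamon2017] D. McDuff, D. Salamon, Introduction to Symplectic Topology, 3rd ed., OUP 2017,
  Ex. 4.4.3 (v), Example 4.3.3, Rem. 4.1.10, §13.3.
* [Hirzebruch1966] F. Hirzebruch, Topological Methods in Algebraic Geometry, 3rd ed., 1966,
  Thm. 4.5.1, Thm. 4.10.1, Thm. 8.2.2.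
* [MilnorStasheff1974] J. Milnor, J. Stasheff, Characteristic Classes, 1974, Cor. 11.12, Thm. 14.10,
  Example 15.6.
* [HatcherAT2002] A. Hatcher, Algebraic Topology, 2002, §3.3 Cor. 3.39.
-/

noncomputable section

open scoped Manifold ContDiff Topology
open Set Function Module
open Literature.AlgebraicTopology.SingularHomology Literature.AlgebraicTopology.CharacteristicClasses
open Literature.Topology.FourManifolds Literature.Geometry.Kaehler Literature.Geometry.Manifold

namespace Literature.Geometry.Symplectic

/-! ### Rank-one unimodular lattices -/

section Lattice

/-- **A perfect bilinear form on a rank-one lattice takes the value `±1` on the generator.**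
[cite: HatcherAT2002, §3.3 Cor. 3.39] -/
theorem apply_self_eq_one_or_eq_neg_one_of_isPerfPair {F : Type*} [AddCommGroup F] [Module ℤ F]
    (Q : LinearMap.BilinForm ℤ F) (hQ : Q.IsPerfPair) (b : Basis Unit ℤ F) :
    Q (b default) (b default) = 1 ∨ Q (b default) (b default) = -1 := by
  haveI := hQ
  obtain ⟨y, hy⟩ := (LinearMap.IsPerfPair.bijective_right Q).2 (b.coord default)
  have hyb := (b.sum_repr y).symm
  rw [Fintype.sum_unique] at hyb
  have e := LinearMap.congr_fun hy (b default)
  rw [LinearMap.flip_apply, Basis.coord_apply, Basis.repr_self, Finsupp.single_eq_same, hyb, map_smulₛₗ, RingHom.id_apply,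
    smul_eq_mul] at e
  exact Int.eq_one_or_neg_one_of_mul_eq_one (by rw [mul_comm]; exact e)

/-- On a rank-one lattice every vector is a multiple of the generator, and a bilinear form scales
by the square: `Q(v, v) = a² Q(g, g)` for `v = a g`. [folklore] -/
theorem apply_self_eq_sq_mul {F : Type*} [AddCommGroup F] [Module ℤ F] (Q : LinearMap.BilinForm ℤ F) (b : Basis Unit ℤ F)
    (v : F) : Q v v = (b.repr v default) ^ 2 * Q (b default) (b default) := by
  have hv := (b.sum_repr v).symm
  rw [Fintype.sum_unique] at hv
  conv_lhs => rw [hv]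
  simp only [map_smulₛₗ, LinearMap.smul_apply, RingHom.id_apply, smul_eq_mul]
  ring

end Lattice

/-! ### The example `(ℂℙ², ω_FS)` -/

section ProjectivePlane

/-- **`⟨p₁(Tℂℙ²), [ℂℙ²]_μ⟩ = 3 Q(x, x)`** for every `ℤ`-orientation `μ`, `x = c₁(γ¹)`
(`p₁(Tℂℙ²) = 3x²`). [cite: MilnorStasheff1974, Example 15.6] -/
theorem pontryaginNumber_complexProjectivePlane (μ : HomologicalOrientation ℤ ComplexProjectivePlane 4) :
    kroneckerPairing ℤ ℤ ComplexProjectivePlane 4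
        (degCast ℤ (by norm_num : 4 * 1 = 4) (tangentPontryaginClass (𝓡 4) ComplexProjectivePlane 1)) μ.fundamentalClass =
      3 * cupPairing μ two_add_two_eq_four xClassCP2 xClassCP2 := by
  have h2 : degCast ℤ (by norm_num : 4 * 1 = 4) (tangentPontryaginClass (𝓡 4) ComplexProjectivePlane 1) =
      degCast ℤ (show 2 * 2 = 4 by norm_num) (xSqClassCP2 + xSqClassCP2 + xSqClassCP2) :=
    tangentPontryaginClass_one_complexProjectiveSpace_two
  have h3 : degCast ℤ (show 2 * 2 = 4 by norm_num) (xSqClassCP2 + xSqClassCP2 + xSqClassCP2) =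
      cupProduct two_add_two_eq_four xClassCP2 xClassCP2 + cupProduct two_add_two_eq_four xClassCP2 xClassCP2 +
        cupProduct two_add_two_eq_four xClassCP2 xClassCP2 :=
    degCast_eq_self ℤ _ _
  rw [h2, h3, cupPairing_apply, map_add, map_add, LinearMap.add_apply, LinearMap.add_apply]
  ring

/-- **The Chern sign bit is `+1`**: computed on `(ℂℙ², ω_FS)` with a compatible almost complex
structure and its symplectic (= complex) orientation, from `p₁(Tℂℙ²) = 3x²`, `χ(ℂℙ²) = 3`,
unimodularity of the cup form on `H²(ℂℙ²; ℤ)/T ≅ ℤ`, and positivity `0 < ⟨[ω]², [ℂℙ²]_μ⟩`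
(which forces `Q(g, g) = +1`); then `a² - 6 εu = 3m²` rules out `εu = -1` modulo `3`.
[cite: McDuffSalamon2017, Ex. 4.4.3 (v) and Example 4.3.3] [cite: MilnorStasheff1974, Example 15.6] [cite: Hirzebruch1966, Thm. 4.5.1] -/
theorem chernSignBit_eq_one : chernSignBit = 1 := by
  -- the symplectic manifold `(ℂℙ², ω)`, a compatible `J`, and its orientation `μ`
  set s : MForm (𝓡 4) ComplexProjectivePlane ℝ 2 := CPn.fsForm 2 with hs_def
  have hs : IsSmoothForm s := PlusOneSpherePair.model_isSmoothForm
  have hcl : IsClosedForm s := PlusOneSpherePair.model_isClosedForm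
  have hnd : ∀ (x : ComplexProjectivePlane) (v : TangentSpace (𝓡 4) x), v ≠ 0 →
      ∃ w : TangentSpace (𝓡 4) x, s x ![v, w] ≠ 0 := PlusOneSpherePair.model_nondegenerate
  set J : AlmostComplexStructure (𝓡 4) ∞ ComplexProjectivePlane := compatibleAlmostComplexStructureOf s hs hnd with hJ_def
  have hJs : J.IsCompatibleWith s := isCompatibleWith_compatibleAlmostComplexStructureOf s hs hnd
  obtain ⟨μ, hμ⟩ := exists_isComplexOrientationOf_of_isCompatibleWith hJs hs
  have hsymp : 0 < symplecticPairing μ s hs hcl :=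
    (isSymplecticOrientationOf_iff μ s hs hcl).1 ((isSymplecticOrientationOf_iff_isComplexOrientationOf hJs hs hcl μ).2 hμ)
  -- the generator `g` of `H²(ℂℙ²; ℤ)/T ≅ ℤ` and its self-intersection `q = ±1`
  set b : Basis Unit ℤ (freeCohomology ℤ ComplexProjectivePlane 2) :=
    (Basis.singleton Unit ℤ).map ComplexProjectivePlane.freeCohomologyTwoLinearEquivInt.symm with hb_def
  obtain ⟨g, hg⟩ := freeCohomology.mk_surjective (R := ℤ) (X := ComplexProjectivePlane) (b default)
  set q : ℤ := cupPairing μ two_add_two_eq_four g g with hq_def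
  have hQ : (intersectionForm two_add_two_eq_four μ).IsPerfPair :=
    isPerfPair_intersectionForm _ μ isPerfPair_cupPairingModTorsion_holds
  have hq : q = 1 ∨ q = -1 := by
    have h := apply_self_eq_one_or_eq_neg_one_of_isPerfPair (intersectionForm two_add_two_eq_four μ) hQ b
    rwa [← hg, intersectionForm_mk_mk] at h
  -- cup squares of integral classes: `Q(c, c) = a² q`
  have hsq : ∀ c : singularCohomology ℤ ℤ ComplexProjectivePlane 2, ∃ a : ℤ, cupPairing μ two_add_two_eq_four c c = a ^ 2 * q := by
    intro c
    refine ⟨b.repr (freeCohomology.mk c) default, ?_⟩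
    have h := apply_self_eq_sq_mul (intersectionForm two_add_two_eq_four μ) b (freeCohomology.mk c)
    rwa [intersectionForm_mk_mk, ← hg, intersectionForm_mk_mk] at h
  -- the real class of `ω` is a real multiple of `g ⊗ 1`
  have hspan := span_ringChange_eq_top (k := 2) (n := 4) two_add_two_eq_four μ b (fun _ ↦ g) fun _ ↦ hg
  have hmem : realClassOfClosedForm s hs hcl ∈
      Submodule.span ℝ (Set.range fun _ : Unit ↦ singularCohomology.ringChange (algebraMap ℤ ℝ) ComplexProjectivePlane 2 g) := by
    rw [hspan]
    exact Submodule.mem_top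
  obtain ⟨t, ht⟩ := (Submodule.mem_span_range_iff_exists_fun ℝ).1 hmem
  rw [Fintype.sum_unique] at ht
  -- positivity forces `q = 1`
  have hq1 : q = 1 := by
    rw [symplecticPairing_eq, realFundamentalClass_eq, ← ht] at hsymp
    simp only [map_smul, LinearMap.smul_apply, smul_eq_mul] at hsymp
    rw [kroneckerPairing_cupProduct_ringChange ℝ two_add_two_eq_four μ g g] at hsymp
    rcases hq with h | h
    · exact h
    · exfalso
      rw [← hq_def, h] at hsymp
      simp only [map_neg, map_one] at hsymp
      nlinarith [mul_self_nonneg (t default)]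
  -- the numbers on `ℂℙ²`
  obtain ⟨a, ha⟩ := hsq J.firstChernClass
  obtain ⟨m, hm⟩ := hsq xClassCP2
  have hp₁ := pontryaginNumber_complexProjectivePlane μ
  have hid := firstChernClass_sq_sub_two_mul_chernNumber_eq_pontryaginNumber ComplexProjectivePlane J μ
  have hc₂ := kroneckerPairing_chernClass_two_of_isComplexOrientationOf J μ hμ
  rw [relEuler_complexProjectivePlane] at hc₂
  rw [hp₁, hc₂, ha, hm, hq1, mul_one, mul_one] at hid
  -- `a² - 2 (3 εu) = 3 m²`: rule out `εu = -1` modulo `3`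
  rcases chernSignBit_eq_one_or_eq_neg_one with h | h
  · exact h
  · exfalso
    rw [h] at hid
    have h3 : (3 : ℤ) ∣ a ^ 2 := ⟨m ^ 2 - 2, by linarith⟩
    obtain ⟨a', rfl⟩ := (Int.prime_three.dvd_of_dvd_pow h3)
    have hm3 : m ^ 2 = 3 * a' ^ 2 + 2 := by linarith
    have key : ∀ z : ZMod 3, z ^ 2 ≠ 2 := by decide
    apply key (m : ZMod 3)
    have e := congrArg (fun z : ℤ ↦ (z : ZMod 3)) hm3
    push_cast at e
    rw [e]
    have h0 : (3 : ZMod 3) = 0 := by decide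
    rw [h0, zero_mul, zero_add]

end ProjectivePlane

/-! ### The top Chern number theorem and the reductions of the named facts -/

section Main

/-- **The top Chern number theorem in dimension four**: for every closed connected almost complex
`4`-manifold `(N, J)` and every homological orientation `μ` induced by `J`,
`⟨c₂(TN, J), [N]_μ⟩ = χ(N)`. [cite: McDuffSalamon2017, Ex. 4.4.3 (v)] [cite: Hirzebruch1966, Thm. 4.10.1] [cite: MilnorStasheff1974, Cor. 11.12] -/
theorem kroneckerPairing_chernClass_two_eq_relEuler {N : Type} [TopologicalSpace N] [T2Space N] [CompactSpace N]
    [ConnectedSpace N] [ChartedSpace (EuclideanSpace ℝ (Fin 4)) N] [IsManifold (𝓡 4) ∞ N]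
    (J : AlmostComplexStructure (𝓡 4) ∞ N) (μ : HomologicalOrientation ℤ N 4) (hμ : μ.IsComplexOrientationOf J) :
    kroneckerPairing ℤ ℤ N 4 (degCast ℤ (by norm_num : 2 * 2 = 4) (J.chernClass 2)) μ.fundamentalClass = relEuler ℤ ℤ N ∅ :=
  kroneckerPairing_chernClass_two_eq_relEuler_of_chernSignBit J chernSignBit_eq_one μ hμ

/-- **(H) `⟨c₁², [N]⟩ = 2χ + 3σ` for closed almost complex `4`-manifolds follows from the signature
theorem `⟨p₁, [N]⟩ = 3σ` alone** (`p₁ = c₁² - 2c₂` and `⟨c₂, [N]⟩ = χ` are proved).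
[cite: McDuffSalamon2017, Rem. 4.1.10 (pp. 161–162)] [cite: Hirzebruch1966, Thm. 4.5.1, Thm. 4.10.1 and Thm. 8.2.2] -/
theorem hirzebruch_firstChernClass_sq_eq_almostComplex_four_of_signatureTheorem
    (hsig : ∀ (N : Type) [TopologicalSpace N] [T2Space N] [SecondCountableTopology N]
      [CompactSpace N] [ConnectedSpace N] [ChartedSpace (EuclideanSpace ℝ (Fin 4)) N]
      [IsManifold (𝓡 4) ∞ N] (μ : HomologicalOrientation ℤ N 4),
      kroneckerPairing ℤ ℤ N 4 (degCast ℤ (by norm_num : 4 * 1 = 4) (tangentPontryaginClass (𝓡 4) N 1))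
        μ.fundamentalClass = 3 * μ.signature) :
    hirzebruch_firstChernClass_sq_eq_almostComplex_four :=
  hirzebruch_firstChernClass_sq_eq_almostComplex_four_of_signatureTheorem_of_chernSignBit hsig chernSignBit_eq_one

/-- **`even_one_add_bOne_add_bPlus_of_symplectic_four` (`1 + b₁ + b⁺` even for closed symplectic
`4`-manifolds) follows from the signature theorem and (V) `c₁ ≡ v₂ (mod 2)`.**
[cite: McDuffSalamon2017, §13.3 p. 527, Rem. 13.3.5 and Rem. 4.1.10] -/
theorem even_one_add_bOne_add_bPlus_of_symplectic_four_of_signatureTheorem_of_wuClass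
    (hsig : ∀ (N : Type) [TopologicalSpace N] [T2Space N] [SecondCountableTopology N]
      [CompactSpace N] [ConnectedSpace N] [ChartedSpace (EuclideanSpace ℝ (Fin 4)) N]
      [IsManifold (𝓡 4) ∞ N] (μ : HomologicalOrientation ℤ N 4),
      kroneckerPairing ℤ ℤ N 4 (degCast ℤ (by norm_num : 4 * 1 = 4) (tangentPontryaginClass (𝓡 4) N 1))
        μ.fundamentalClass = 3 * μ.signature)
    (hV : firstChernClass_modTwo_eq_wuClass_almostComplex_four) :
    even_one_add_bOne_add_bPlus_of_symplectic_four :=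
  even_one_add_bOne_add_bPlus_of_symplectic_four_of_signatureTheorem_of_chernSignBit_of_wuClass hsig chernSignBit_eq_one hV

end Main

end Literature.Geometry.Symplectic

end
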